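import Mathlib
import HarnessLib
import Summits.ValiantsHypothesis.ValiantsHypothesis.Theorems.MonotoneRestorationOrbitRestorationQPColUntwistedProducts
import Summits.ValiantsHypothesis.ValiantsHypothesis.Theorems.MonotoneRestorationOrbitRestorationQPSquaresSpan

/-!
# Matrix-symmetric affine products: column-untwistedness is a condition on the label STABILISERS only; column supports of size ≤ 1

Route MonotoneRestoration, crux `OrbitRestorationQP` (stmt-ValiantsHypothesis-18293), SPAN-currency lane of the open
sub-rung A_∞ (`stub_sigmaPiSigmaValue`), `ΠΣ` part; residue R3 of `BLOCK-LANE-g7g5.md`.  Helper (`--supports`), def-free.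
Sharpens `SuperAtoms.prod_mem_narrowSpan_of_colUntwisted_matrixSymmetric_supports`:

* **`prod_mem_narrowSpan_of_colStabUntwisted_supports`** — the column-untwistedness hypothesis is only needed for
  OCCURRING labels `T = S(L_i)` and renamings `τ` with `τ • T = T` (a renaming moving the label cannot stabilise the
  line of the grouping: unique factorisation, `NormalisedFactors.label_eq_of_block_sq_eq`); i.e. the hypothesis is
  exactly "the `Sym(T)`-character of every column grouping is trivial";
* **`prod_mem_narrowSpan_of_colSupportLeOne_supports`** — COROLLARY: if every factor has column support of size `≤ 1`
  (each factor is fixed by the column renamings fixing one column — e.g. the column Vandermondes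
  `W_n = Π_q Π_{a<a'} (x_{aq} − x_{a'q})`, their generalisations `Π_q Π_{a<a'} (α(x_{aq} − x_{a'q}) + β(R_a − R_{a'}) + …)`,
  and every product of forms in `x_{aq}, R_a, C_q, U`), then `C a · Π_i L_i ∈ span_ℂ {hom_{F,n} : tw F ≤ 3}` — the label
  stabilisers are trivial, so NO twist hypothesis at all remains: every such matrix-symmetric `ΠΣ` polynomial has
  polynomial orbits, whatever its row sign characters.

No registered stub is closed; the crux and VP ≠ VNP are not moved. [folklore; cite: DwivediPagoSeppelt2026, §8]
-/

noncomputable section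

open scoped Pointwise

-- `Summit.ValiantsHypothesis.ValiantsHypothesis.…` is the tree's single-conjunct layout (Sub = Summit).
set_option linter.dupNamespace false

namespace Summit.ValiantsHypothesis.ValiantsHypothesis.Theorems

namespace SuperAtoms

open MvPolynomial Finset Equiv ProductAction
open Literature.Computability.AlgebraicComplexity (homPoly)
open Literature.Combinatorics.SimpleGraph (treewidth)

variable {n : ℕ}

/-- **Column-untwistedness is a condition on the label stabilisers only (supports form).**  As
`prod_mem_narrowSpan_of_colUntwisted_matrixSymmetric_supports`, but the hypothesis "no column renaming rescales a
grouping non-trivially" is only required for occurring labels `T` and renamings with `τ • T = T`.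
[folklore; cite: DwivediPagoSeppelt2026, §8] -/
theorem prod_mem_narrowSpan_of_colStabUntwisted_supports (c₀ : ℕ) (hc₀ : 2 * c₀ < n)
    {ι : Type} [Fintype ι] (L : ι → MvPolynomial (Fin n × Fin n) ℂ) (a : ℂ) (hL1 : ∀ i, (L i).totalDegree = 1)
    (hf0 : C a * ∏ i, L i ≠ 0)
    (hfix : ∀ σ τ : Perm (Fin n),
      rename (fun P : Fin n × Fin n => (σ P.1, τ P.2)) (C a * ∏ i, L i) = C a * ∏ i, L i)
    (S : MvPolynomial (Fin n × Fin n) ℂ → Finset (Fin n))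
    (S1 : ∀ (q : MvPolynomial (Fin n × Fin n) ℂ) (u : ℂ), u ≠ 0 → S (C u * q) = S q)
    (S2 : ∀ (q : MvPolynomial (Fin n × Fin n) ℂ) (τ : Perm (Fin n)), S (vact (K := ℂ) colHom τ q) = τ • S q)
    (S3 : ∀ (q : MvPolynomial (Fin n × Fin n) ℂ) (σ : Perm (Fin n)), S (vact (K := ℂ) rowHom σ q) = S q)
    (hSk : ∀ i, (S (L i)).card ≤ c₀)
    (hSfix : ∀ (i : ι) (ρ : Perm (Fin n)), (∀ x ∈ S (L i), ρ x = x) → vact (K := ℂ) colHom ρ (L i) = L i)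
    (Hstab : ∀ (τ : Perm (Fin n)) (T : Finset (Fin n)) (c : ℂ), (∃ i, S (L i) = T) → τ • T = T →
      rename (fun P : Fin n × Fin n => (P.1, τ P.2)) (∏ i ∈ (univ : Finset ι).filter (fun i => S (L i) = T), L i) =
        C c * ∏ i ∈ (univ : Finset ι).filter (fun i => S (L i) = T), L i → c = 1) :
    (C a * ∏ i, L i) ∈ Submodule.span ℂ {p : MvPolynomial (Fin n × Fin n) ℂ |
        ∃ (a b : ℕ) (E : Multiset (Fin a × Fin b)),
          treewidth (SimpleGraph.fromRel fun u v : Fin a ⊕ Fin b =>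
            ∃ e ∈ E, u = Sum.inl e.1 ∧ v = Sum.inr e.2) ≤ 2 * c₀ + 1 ∧ p = homPoly E n ℂ} := by
  classical
  have hL0 : ∀ i, L i ≠ 0 := by
    intro i h
    exact hf0 (by rw [Finset.prod_eq_zero (Finset.mem_univ i) h, mul_zero])
  refine prod_mem_narrowSpan_of_colUntwisted_matrixSymmetric_supports c₀ hc₀ L a hL1 hf0 hfix S S1 S2 S3 hSk hSfix
    fun τ T c h => ?_
  by_cases hocc : ∃ i, S (L i) = T
  · -- the renaming transports the grouping to the grouping of `τ • T`; proportional groupings have equal labels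
    obtain ⟨u, hu0, hu⟩ := NormalisedFactors.exists_unit_labelBlock_rowCol L a hL1 hf0 1 τ (hfix 1 τ) S
      (fun T : Finset (Fin n) => τ • T) (fun T T' h => smul_left_cancel τ h) S1 (fun i => by
        rw [rename_prod_eq, S3, S2]) T
    have hconv : rename (fun P : Fin n × Fin n => (((1 : Perm (Fin n)) P.1), τ P.2))
        (∏ i ∈ (univ : Finset ι).filter (fun i => S (L i) = T), L i) =
        rename (fun P : Fin n × Fin n => (P.1, τ P.2))
        (∏ i ∈ (univ : Finset ι).filter (fun i => S (L i) = T), L i) := rfl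
    rw [hconv, h] at hu
    have hsq : C (c ^ 2) * (∏ i ∈ (univ : Finset ι).filter (fun i => S (L i) = T), L i) ^ 2 =
        C (u ^ 2) * (∏ i ∈ (univ : Finset ι).filter (fun i => S (L i) = τ • T), L i) ^ 2 := by
      rw [map_pow, map_pow, ← mul_pow, ← mul_pow, hu]
    have hT : τ • T = T :=
      NormalisedFactors.label_eq_of_block_sq_eq L hL1 hL0 S S1 T (τ • T) hocc (c ^ 2) (u ^ 2) (pow_ne_zero 2 hu0) hsq
    exact Hstab τ T c hocc hT h
  · -- no factor has this label: the grouping is `1`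
    have hempty : (univ : Finset ι).filter (fun i => S (L i) = T) = ∅ :=
      Finset.filter_eq_empty_iff.2 fun i _ hi => hocc ⟨i, hi⟩
    rw [hempty, Finset.prod_empty, map_one, mul_one] at h
    exact (C_injective _ _ (by rw [C_1]; exact h.symm))

/-- **COROLLARY: factors with column supports of size `≤ 1`.**  If every factor of the matrix-symmetric affine product
has column support of size `≤ 1` (`n > 2`), then `C a · Π_i L_i ∈ span_ℂ {hom_{F,n} : tw F ≤ 3}` — no twist hypothesis:
the label stabilisers fix the labels pointwise.  Covers the column Vandermondes `W_n` (`n` even) and all their affine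
generalisations. [folklore; cite: DwivediPagoSeppelt2026, §8] -/
theorem prod_mem_narrowSpan_of_colSupportLeOne_supports (hn : 2 < n)
    {ι : Type} [Fintype ι] (L : ι → MvPolynomial (Fin n × Fin n) ℂ) (a : ℂ) (hL1 : ∀ i, (L i).totalDegree = 1)
    (hf0 : C a * ∏ i, L i ≠ 0)
    (hfix : ∀ σ τ : Perm (Fin n),
      rename (fun P : Fin n × Fin n => (σ P.1, τ P.2)) (C a * ∏ i, L i) = C a * ∏ i, L i)
    (S : MvPolynomial (Fin n × Fin n) ℂ → Finset (Fin n))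
    (S1 : ∀ (q : MvPolynomial (Fin n × Fin n) ℂ) (u : ℂ), u ≠ 0 → S (C u * q) = S q)
    (S2 : ∀ (q : MvPolynomial (Fin n × Fin n) ℂ) (τ : Perm (Fin n)), S (vact (K := ℂ) colHom τ q) = τ • S q)
    (S3 : ∀ (q : MvPolynomial (Fin n × Fin n) ℂ) (σ : Perm (Fin n)), S (vact (K := ℂ) rowHom σ q) = S q)
    (hS1 : ∀ i, (S (L i)).card ≤ 1)
    (hSfix : ∀ (i : ι) (ρ : Perm (Fin n)), (∀ x ∈ S (L i), ρ x = x) → vact (K := ℂ) colHom ρ (L i) = L i) :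
    (C a * ∏ i, L i) ∈ Submodule.span ℂ {p : MvPolynomial (Fin n × Fin n) ℂ |
        ∃ (a b : ℕ) (E : Multiset (Fin a × Fin b)),
          treewidth (SimpleGraph.fromRel fun u v : Fin a ⊕ Fin b =>
            ∃ e ∈ E, u = Sum.inl e.1 ∧ v = Sum.inr e.2) ≤ 3 ∧ p = homPoly E n ℂ} := by
  classical
  have hL0 : ∀ i, L i ≠ 0 := by
    intro i h
    exact hf0 (by rw [Finset.prod_eq_zero (Finset.mem_univ i) h, mul_zero])
  have h := prod_mem_narrowSpan_of_colStabUntwisted_supports 1 (by omega) L a hL1 hf0 hfix S S1 S2 S3 hS1 hSfix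
    fun τ T c hocc hτT h => ?_
  · simpa using h
  · obtain ⟨i₀, hi₀⟩ := hocc
    -- `τ` fixes the (at most one) element of `T`, hence every factor with label `T`
    have hfixT : ∀ x ∈ T, τ x = x := by
      intro x hx
      have hτx : τ x ∈ T := by
        rw [← hτT]
        exact Finset.smul_mem_smul_finset hx
      have hcard : T.card ≤ 1 := by rw [← hi₀]; exact hS1 i₀
      exact Finset.card_le_one.1 hcard _ hτx _ hx
    have hG : rename (fun P : Fin n × Fin n => (P.1, τ P.2))
        (∏ i ∈ (univ : Finset ι).filter (fun i => S (L i) = T), L i) =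
        ∏ i ∈ (univ : Finset ι).filter (fun i => S (L i) = T), L i := by
      rw [map_prod]
      refine Finset.prod_congr rfl fun i hi => ?_
      have hiT : S (L i) = T := (Finset.mem_filter.1 hi).2
      rw [← vact_colHom_eq_rename]
      exact hSfix i τ fun x hx => hfixT x (by rwa [hiT] at hx)
    rw [hG] at h
    have hG0 : (∏ i ∈ (univ : Finset ι).filter (fun i => S (L i) = T), L i) ≠ 0 :=
      Finset.prod_ne_zero_iff.2 fun i _ => hL0 i
    exact (scalar_eq_of_mul_eq hG0 (by rw [C_1, one_mul]; exact h)).symm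

end SuperAtoms

end Summit.ValiantsHypothesis.ValiantsHypothesis.Theorems

end
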